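import Literature.Analysis.FluidPDE.ReleaseKernelMarginal
import Literature.Analysis.FluidPDE.TwoPointSliceBounds
import HarnessLib

/-!
# The logarithmic separation functional of the reversed kernel family, I: slices

Analysis/FluidPDE proof-support file (everything proved). Let `u` be a smooth divergence-free
drift on `[0,T] × T^d`, `κ = δ² > 0`, `0 < ε ≤ 1/4`, let `χ^w` be its reversed kernel family
(`FluidPDE/ReleaseKernelFamily`, `∂_τχ^w - u(T-τ)·∇χ^w = κΔχ^w`, `χ^w(0) = k_ε(· - w)`) and
`Φ_δ` the smooth periodic logarithmic cost (`FunctionSpaces/PeriodicLogCost`). The generator of the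
pair functional `∫∫ Φ_δ(x-y) χ^w(τ,x) χ^w(τ,y)` (`FluidPDE/TwoPointPairFunctional`) is

  `g(w,τ) = 2 ∫ χ^w(τ,x) ∫ χ^w(τ,y) (κ ΔΦ_δ(x-y) - u(T-τ,x)·∇Φ_δ(x-y)) dy dx`.

We prove the slice bound `g(w,τ) ≤ 4π² d + 2π ∫ Ψ_τ χ^w(τ)` with the two-point maximal majorant
`Ψ_τ` of `u(T-τ)` (`generator_reversedKernel_le`), the continuity of `w ↦ g(w,τ)`, and, using the
**Lebesgue marginals** of the two-point density `∫ χ^w(τ,x)χ^w(τ,y) dw`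
(`ae_integral_reversedKernel_eq_one`), the `w`-integrated bound

  `∫ g(w,τ) dw ≤ 4π² d + 2π (C_d · d · ‖∇u(T-τ)‖²_{L²})^{1/2}`
  (`integral_generator_reversedKernel_le`).

This is the slice-wise heart of the two-point (backward characteristics) form of the
Crippa–De Lellis logarithmic estimate.

## References

* G. Crippa, C. De Lellis, J. reine angew. Math. 616 (2008), Thm. 2.1 / §2.
* C. Seis, Comm. Math. Phys. 399 (2023) = arXiv:2003.08794, Lemma 3 and §2.2. [`Seis2022`]
-/

noncomputable section

open MeasureTheory Set Filter Topology Function Metric Real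
open scoped InnerProductSpace ENNReal Convolution
open Literature.Analysis.FunctionSpaces Literature.Analysis.FunctionSpaces.Torus
open Literature.Analysis.SingularIntegrals Literature.Analysis.SingularIntegrals.Torus

namespace Literature.Analysis.FluidPDE

namespace Torus

variable {d : Type*} [Fintype d] [DecidableEq d]

section Evolution

variable {κ T ε δ : ℝ} {u : ℝ → UnitAddTorus d → EuclideanSpace ℝ d}
  {χ : UnitAddTorus d → ℝ → UnitAddTorus d → ℝ}

omit [DecidableEq d] in
/-- A sup bound for the torus mollifier. [folklore] -/
theorem exists_kernel_le (hε : 0 < ε) (hε4 : ε ≤ 1 / 4) : ∃ K : ℝ, 0 ≤ K ∧ ∀ z : UnitAddTorus d, kernel ε z ≤ K := by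
  obtain ⟨K, hK⟩ := (isCompact_univ (X := UnitAddTorus d)).exists_bound_of_continuousOn
    (continuous_kernel hε hε4).continuousOn
  refine ⟨K, (norm_nonneg _).trans (hK 0 (mem_univ _)), fun z => ?_⟩
  exact (le_abs_self _).trans ((Real.norm_eq_abs _).symm.le.trans (hK z (mem_univ _)))

omit [DecidableEq d] in
/-- Splitting the generator of a slice into its diffusion and transport parts. [folklore] -/
theorem integral_generator_split {f : UnitAddTorus d → ℝ} (hfc : Continuous f)
    {V : UnitAddTorus d → EuclideanSpace ℝ d} (hVc : Continuous V) (κ δ : ℝ) :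
    ∫ x, f x * ∫ y, f y * (κ * FunctionSpaces.Torus.laplacian (sinLogCost δ) (x - y) +
        ⟪V x, Torus.gradient (sinLogCost δ) (x - y)⟫_ℝ) =
      (∫ x, f x * ∫ y, f y * (κ * FunctionSpaces.Torus.laplacian (sinLogCost δ) (x - y))) +
        ∫ x, f x * ∫ y, f y * ⟪V x, Torus.gradient (sinLogCost δ) (x - y)⟫_ℝ := by
  have hLc : Continuous (FunctionSpaces.Torus.laplacian (sinLogCost δ) : UnitAddTorus d → ℝ) :=
    continuous_laplacian_sinLogCost δ
  have hGc : Continuous (Torus.gradient (sinLogCost δ) : UnitAddTorus d → EuclideanSpace ℝ d) :=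
    continuous_gradient_sinLogCost δ
  have i1 : ∀ x, Integrable (fun y => f y * (κ * FunctionSpaces.Torus.laplacian (sinLogCost δ) (x - y))) volume :=
    fun x => (hfc.mul (continuous_const.mul (hLc.comp (continuous_const.sub continuous_id)))).integrable_unitAddTorus
  have i2 : ∀ x, Integrable (fun y => f y * ⟪V x, Torus.gradient (sinLogCost δ) (x - y)⟫_ℝ) volume :=
    fun x => (hfc.mul (continuous_const.inner (hGc.comp (continuous_const.sub continuous_id)))).integrable_unitAddTorus
  have e : ∀ x, f x * ∫ y, f y * (κ * FunctionSpaces.Torus.laplacian (sinLogCost δ) (x - y) +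
      ⟪V x, Torus.gradient (sinLogCost δ) (x - y)⟫_ℝ) =
      (f x * ∫ y, f y * (κ * FunctionSpaces.Torus.laplacian (sinLogCost δ) (x - y))) +
        f x * ∫ y, f y * ⟪V x, Torus.gradient (sinLogCost δ) (x - y)⟫_ℝ := by
    intro x
    rw [← mul_add, ← integral_add (i1 x) (i2 x)]
    congr 1
    exact integral_congr_ae (Eventually.of_forall fun y => by ring)
  simp_rw [e]
  have c1 : Continuous (uncurry fun x y : UnitAddTorus d => f y * (κ * FunctionSpaces.Torus.laplacian (sinLogCost δ) (x - y))) :=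
    (hfc.comp continuous_snd).mul (continuous_const.mul (hLc.comp (continuous_fst.sub continuous_snd)))
  have c2 : Continuous (uncurry fun x y : UnitAddTorus d => f y * ⟪V x, Torus.gradient (sinLogCost δ) (x - y)⟫_ℝ) :=
    (hfc.comp continuous_snd).mul ((hVc.comp continuous_fst).inner (hGc.comp (continuous_fst.sub continuous_snd)))
  have j1 : Integrable (fun x => ∫ y, f y * (κ * FunctionSpaces.Torus.laplacian (sinLogCost δ) (x - y))) volume :=
    (integrable_prod_of_continuous c1).integral_prod_left
  have j2 : Integrable (fun x => ∫ y, f y * ⟪V x, Torus.gradient (sinLogCost δ) (x - y)⟫_ℝ) volume :=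
    (integrable_prod_of_continuous c2).integral_prod_left
  exact integral_add (integrable_continuous_mul_of_integrable hfc j1) (integrable_continuous_mul_of_integrable hfc j2)

/-- **The slice generator bound**: for a continuous probability density `f`, a continuous field
`V` with two-point majorant `Ψ ∈ L²`, `κ = δ²`:
`2 ∫ f(x) ∫ f(y) (κ ΔΦ_δ(x-y) + V(x)·∇Φ_δ(x-y)) ≤ 4π² d + 2π ∫ Ψ f`. [folklore] -/
theorem generator_slice_le {f : UnitAddTorus d → ℝ} (hfc : Continuous f) (hf0 : ∀ x, 0 ≤ f x)
    (hf1 : ∫ x, f x = 1) {V : UnitAddTorus d → EuclideanSpace ℝ d} (hVc : Continuous V)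
    {Ψ : UnitAddTorus d → ℝ} (hΨ0 : ∀ x, 0 ≤ Ψ x) (hΨ2 : MemLp Ψ 2 volume)
    (h2pt : ∀ x y, ‖V x - V y‖ ≤ dist x y * (Ψ x + Ψ y)) (hδ : 0 < δ) (hκδ : κ = δ ^ 2) :
    2 * ∫ x, f x * ∫ y, f y * (κ * FunctionSpaces.Torus.laplacian (sinLogCost δ) (x - y) +
        ⟪V x, Torus.gradient (sinLogCost δ) (x - y)⟫_ℝ) ≤
      4 * π ^ 2 * Fintype.card d + 2 * π * ∫ x, Ψ x * f x := by
  have h1 := two_mul_integral_integral_laplacian_le hfc hf0 hf1 hδ.ne' hκδ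
  have h2 := two_mul_integral_integral_inner_gradient_le hfc hf0 hf1 hVc hΨ0 hΨ2 h2pt hδ.ne'
  have h3 := integral_generator_split hfc hVc κ δ
  rw [h3, mul_add]
  exact add_le_add h1 h2

/-- Continuity in the parameter of pair integrals of the reversed kernels against a continuous
two-point kernel `K`. [folklore] -/
theorem continuous_pair_integral_reversedKernel (hκ : 0 ≤ κ) (hε : 0 < ε) (hε4 : ε ≤ 1 / 4)
    (hχ : ∀ w, IsClassicalScalarTransportOn (Icc 0 T) κ (fun τ x => -u (T - τ) x) (χ w))
    (hχ0 : ∀ w x, χ w 0 x = kernel ε (x - w)) {τ : ℝ} (hτ : τ ∈ Icc 0 T)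
    {K : UnitAddTorus d → UnitAddTorus d → ℝ} (hKc : Continuous (uncurry K)) :
    Continuous (fun w : UnitAddTorus d => ∫ x, χ w τ x * ∫ y, χ w τ y * K x y) := by
  have hχc := continuous_reversedKernel_slice hκ hε hε4 hχ hχ0 hτ
  have hJ1 : Continuous (fun q : (UnitAddTorus d × UnitAddTorus d) × UnitAddTorus d => χ q.1.1 τ q.2) :=
    hχc.comp (continuous_fst.fst.prodMk continuous_snd)
  have hJ2 : Continuous (fun q : (UnitAddTorus d × UnitAddTorus d) × UnitAddTorus d => K q.1.2 q.2) :=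
    hKc.comp (continuous_fst.snd.prodMk continuous_snd)
  have hJc : Continuous (fun q : (UnitAddTorus d × UnitAddTorus d) × UnitAddTorus d => χ q.1.1 τ q.2 * K q.1.2 q.2) :=
    hJ1.mul hJ2
  have hinner' := continuous_parametric_integral_of_continuous
    (f := fun (p : UnitAddTorus d × UnitAddTorus d) (y : UnitAddTorus d) => χ p.1 τ y * K p.2 y)
    hJc (isCompact_univ (X := UnitAddTorus d)) (μ := volume)
  have hinner : Continuous (fun p : UnitAddTorus d × UnitAddTorus d => ∫ y, χ p.1 τ y * K p.2 y) := by
    refine hinner'.congr fun p => ?_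
    rw [Measure.restrict_univ]
  have h2 : Continuous (fun p : UnitAddTorus d × UnitAddTorus d => χ p.1 τ p.2 * ∫ y, χ p.1 τ y * K p.2 y) :=
    hχc.mul hinner
  have houter' := continuous_parametric_integral_of_continuous
    (f := fun (w x : UnitAddTorus d) => χ w τ x * ∫ y, χ w τ y * K x y)
    h2 (isCompact_univ (X := UnitAddTorus d)) (μ := volume)
  refine houter'.congr fun w => ?_
  rw [Measure.restrict_univ]

/-- **The generator bound for the reversed kernels, slice-wise**: with the two-point majorant
`Ψ` of `u(T-τ)`, `g(w,τ) ≤ 4π² d + 2π ∫ Ψ χ^w(τ)`. [folklore] -/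
theorem generator_reversedKernel_le (hκ : 0 < κ) (hu : FunctionSpaces.Torus.IsSmoothSpaceTimeOn (Icc 0 T) u)
    (hε : 0 < ε) (hε4 : ε ≤ 1 / 4)
    (hχ : ∀ w, IsClassicalScalarTransportOn (Icc 0 T) κ (fun τ x => -u (T - τ) x) (χ w))
    (hχ0 : ∀ w x, χ w 0 x = kernel ε (x - w)) (hδ : 0 < δ) (hκδ : κ = δ ^ 2)
    {τ : ℝ} (hτ : τ ∈ Icc 0 T) {Ψ : UnitAddTorus d → ℝ} (hΨ0 : ∀ x, 0 ≤ Ψ x) (hΨ2 : MemLp Ψ 2 volume)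
    (h2pt : ∀ x y, ‖u (T - τ) x - u (T - τ) y‖ ≤ dist x y * (Ψ x + Ψ y)) (w : UnitAddTorus d) :
    2 * ∫ x, χ w τ x * ∫ y, χ w τ y *
        (κ * FunctionSpaces.Torus.laplacian (sinLogCost δ) (x - y) +
          ⟪-u (T - τ) x, Torus.gradient (sinLogCost δ) (x - y)⟫_ℝ) ≤
      4 * π ^ 2 * Fintype.card d + 2 * π * ∫ x, Ψ x * χ w τ x := by
  have hTτ : T - τ ∈ Icc 0 T := ⟨by linarith [hτ.2], by linarith [hτ.1]⟩
  have hVc : Continuous (fun x => -u (T - τ) x) := (hu.isSmooth_slice hTτ).continuous.neg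
  have h2ptV : ∀ x y, ‖-u (T - τ) x - -u (T - τ) y‖ ≤ dist x y * (Ψ x + Ψ y) := fun x y => by
    rw [← neg_sub', norm_neg]; exact h2pt x y
  exact generator_slice_le ((hχ w).smooth_scalar.isSmooth_slice hτ).continuous
    (fun x => reversedKernel_nonneg hκ.le hε.le hχ hχ0 w hτ x) (integral_reversedKernel_eq_one hε hε4 hχ hχ0 w hτ)
    hVc hΨ0 hΨ2 h2ptV hδ hκδ

/-- Fubini and the marginal identity: `∫ (∫ Ψ(x) χ^w(τ,x) dx) dw = ∫ Ψ`, and continuity of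
`w ↦ ∫ Ψ χ^w(τ)`. [folklore] -/
theorem integral_integral_mul_reversedKernel_eq (hκ : 0 < κ) (hu : FunctionSpaces.Torus.IsSmoothSpaceTimeOn (Icc 0 T) u)
    (hdiv : ∀ t ∈ Icc 0 T, IsDivFree (u t)) (hε : 0 < ε) (hε4 : ε ≤ 1 / 4)
    (hχ : ∀ w, IsClassicalScalarTransportOn (Icc 0 T) κ (fun τ x => -u (T - τ) x) (χ w))
    (hχ0 : ∀ w x, χ w 0 x = kernel ε (x - w)) {τ : ℝ} (hτ : τ ∈ Icc 0 T)
    {Ψ : UnitAddTorus d → ℝ} (hΨm : Measurable Ψ) (hΨ0 : ∀ x, 0 ≤ Ψ x) (hΨi : Integrable Ψ volume) :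
    Continuous (fun w : UnitAddTorus d => ∫ x, Ψ x * χ w τ x) ∧
      ∫ w, ∫ x, Ψ x * χ w τ x = ∫ x, Ψ x := by
  obtain ⟨K, -, hK⟩ := exists_kernel_le (d := d) hε hε4
  have hf0 : ∀ w x, 0 ≤ χ w τ x := fun w x => reversedKernel_nonneg hκ.le hε.le hχ hχ0 w hτ x
  have hfK : ∀ w x, χ w τ x ≤ K := fun w x => reversedKernel_le hκ.le hK hχ hχ0 w hτ x
  have hfc : ∀ w, Continuous (χ w τ) := fun w => ((hχ w).smooth_scalar.isSmooth_slice hτ).continuous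
  have hχc := continuous_reversedKernel_slice hκ.le hε hε4 hχ hχ0 hτ
  have hbd : ∀ w x, ‖Ψ x * χ w τ x‖ ≤ K * Ψ x := fun w x => by
    rw [norm_mul, Real.norm_of_nonneg (hΨ0 x), Real.norm_of_nonneg (hf0 w x), mul_comm]
    exact mul_le_mul_of_nonneg_right (hfK w x) (hΨ0 x)
  refine ⟨?_, ?_⟩
  · exact continuous_of_dominated (bound := fun x => K * Ψ x)
      (fun w => hΨm.aestronglyMeasurable.mul (hfc w).aestronglyMeasurable)
      (fun w => Eventually.of_forall (hbd w)) (hΨi.const_mul K)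
      (Eventually.of_forall fun x => continuous_const.mul (continuous_reversedKernel_param hκ.le hε hε4 hχ hχ0 hτ x))
  · have hint : Integrable (uncurry fun (w x : UnitAddTorus d) => Ψ x * χ w τ x) (volume.prod volume) := by
      refine Integrable.mono' (MeasureTheory.Integrable.mul_prod (integrable_const K) hΨi) ?_
        (Eventually.of_forall fun p => hbd p.1 p.2)
      exact (hΨm.comp measurable_snd).aestronglyMeasurable.mul
        (hχc.comp (continuous_fst.prodMk continuous_snd)).aestronglyMeasurable
    rw [integral_integral_swap hint]
    have hae := ae_integral_reversedKernel_eq_one hκ hu hdiv hε hε4 hχ hχ0 hτ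
    refine integral_congr_ae ?_
    filter_upwards [hae] with x hx
    show ∫ w, Ψ x * χ w τ x = Ψ x
    rw [integral_const_mul, hx, mul_one]

/-- **The `w`-integrated generator bound.** For `τ ∈ [0,T]`:
`∫ g(w,τ) dw ≤ 4π² d + 2π (C_d · d · ‖∇u(T-τ)‖²_{L²})^{1/2}` (`gradNormSq = ∫ ∑ᵢ ‖∂ᵢu‖²`).
[folklore] -/
theorem integral_generator_reversedKernel_le (hκ : 0 < κ) (hu : FunctionSpaces.Torus.IsSmoothSpaceTimeOn (Icc 0 T) u)
    (hdiv : ∀ t ∈ Icc 0 T, IsDivFree (u t)) (hε : 0 < ε) (hε4 : ε ≤ 1 / 4)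
    (hχ : ∀ w, IsClassicalScalarTransportOn (Icc 0 T) κ (fun τ x => -u (T - τ) x) (χ w))
    (hχ0 : ∀ w x, χ w 0 x = kernel ε (x - w)) (hδ : 0 < δ) (hκδ : κ = δ ^ 2)
    {τ : ℝ} (hτ : τ ∈ Icc 0 T) :
    ∫ w, (2 * ∫ x, χ w τ x * ∫ y, χ w τ y *
        (κ * FunctionSpaces.Torus.laplacian (sinLogCost δ) (x - y) +
          ⟪-u (T - τ) x, Torus.gradient (sinLogCost δ) (x - y)⟫_ℝ)) ≤
      4 * π ^ 2 * Fintype.card d + 2 * π * Real.sqrt ((twoPointL2Const d).toReal *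
        (Fintype.card d * gradNormSq (u (T - τ)))) := by
  have hTτ : T - τ ∈ Icc 0 T := ⟨by linarith [hτ.2], by linarith [hτ.1]⟩
  have huτ : IsSmooth (u (T - τ)) := hu.isSmooth_slice hTτ
  obtain ⟨Ψ, hΨm, hΨ0, h2pt, hΨ2, hΨint⟩ := exists_real_twoPoint_majorant huτ
  have hΨi : Integrable Ψ volume := hΨ2.integrable one_le_two
  obtain ⟨hRc, hswap⟩ := integral_integral_mul_reversedKernel_eq hκ hu hdiv hε hε4 hχ hχ0 hτ hΨm hΨ0 hΨi
  have hVc : Continuous (fun x => -u (T - τ) x) := huτ.continuous.neg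
  have hKc : Continuous (uncurry fun x y : UnitAddTorus d =>
      κ * FunctionSpaces.Torus.laplacian (sinLogCost δ) (x - y) + ⟪-u (T - τ) x, Torus.gradient (sinLogCost δ) (x - y)⟫_ℝ) :=
    (continuous_const.mul ((continuous_laplacian_sinLogCost δ).comp (continuous_fst.sub continuous_snd))).add
      ((hVc.comp continuous_fst).inner ((continuous_gradient_sinLogCost δ).comp (continuous_fst.sub continuous_snd)))
  have hLc : Continuous (fun w : UnitAddTorus d => 2 * ∫ x, χ w τ x * ∫ y, χ w τ y *
      (κ * FunctionSpaces.Torus.laplacian (sinLogCost δ) (x - y) + ⟪-u (T - τ) x, Torus.gradient (sinLogCost δ) (x - y)⟫_ℝ)) :=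
    continuous_const.mul (continuous_pair_integral_reversedKernel hκ.le hε hε4 hχ hχ0 hτ hKc)
  have hper := generator_reversedKernel_le hκ hu hε hε4 hχ hχ0 hδ hκδ hτ hΨ0 hΨ2 h2pt
  have iR : Integrable (fun w : UnitAddTorus d => 4 * π ^ 2 * (Fintype.card d : ℝ) + 2 * π * ∫ x, Ψ x * χ w τ x) volume :=
    (continuous_const.add (continuous_const.mul hRc)).integrable_unitAddTorus
  have hmono := integral_mono hLc.integrable_unitAddTorus iR hper
  have hgrad : (eGradNormSq (u (T - τ))).toReal = gradNormSq (u (T - τ)) :=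
    (gradNormSq_eq_toReal_eGradNormSq_holds huτ).symm
  have hconst : ∫ _ : UnitAddTorus d, (4 * π ^ 2 * (Fintype.card d : ℝ)) = 4 * π ^ 2 * Fintype.card d := by
    rw [integral_const, probReal_univ, one_smul]
  refine hmono.trans ?_
  have i2 : Integrable (fun w : UnitAddTorus d => 2 * π * ∫ x, Ψ x * χ w τ x) volume :=
    (continuous_const.mul hRc).integrable_unitAddTorus
  rw [integral_add (integrable_const _) i2, hconst, integral_const_mul, hswap, ← hgrad]
  linarith [mul_le_mul_of_nonneg_left hΨint (by positivity : (0 : ℝ) ≤ 2 * π)]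

end Evolution

end Torus

end Literature.Analysis.FluidPDE
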